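import Summits.NavierStokesRegularity.NavierStokesRegularity.Theorems.TypeIQuarterGateQuarterLawTypeIOctaveSampling
import HarnessLib

/-!
# `TypeIQuarterGate`: the TIME-SAMPLING forms of the quarter law along ONE Type-I blow-up are all
# equivalent (crux `QuarterLawTypeI`, stmt-NavierStokesRegularity-23726)

`--supports stmt-NavierStokesRegularity-23726` (helper; sequel to
`Theorems/TypeIQuarterGateQuarterLawTypeIOctaveSampling.lean`, p824687).  One entry point for the
seats of this crux: along a FIXED classical Leray–Hopf rapidly-decaying-datum solution on `[0,T)` with
the sup-norm Type-I rate (`IsTypeIBlowup u T`), writing `Z(t) = ∫‖curl u(t)‖²`, the following are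
equivalent (`quarterLaw_sampling_tfae`):

1. SLICE LAW on `[0,T)`: `∃ K, ∀ t ∈ [0,T), Z(t) ≤ K/√(T−t)` (K1's conclusion verbatim);
2. EVENTUAL slice law: the same on some `[t₀,T)` (tree `LorentzOfEnvelope.quarterLaw_of_eventually`);
3. OCTAVE SAMPLING: some `K, q, t₀ < T` such that every `t ∈ [t₀,T)` has a slice `s ∈ [0,t]` with
   `T−s ≤ q(T−t)` and `Z(s) ≤ K/√(T−s)` (p824687);
4. DYADIC SAMPLING: `∃ K, ∀ n, Z(T − T/2^{n+1}) ≤ K/√(T/2^{n+1})`;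
5. BACKWARD-WINDOW LAW: `∫_{2t−T}^{t} Z ≤ K√(T−t)` for `t` near `T` (the law of p823679, per solution);
6. TERMINAL-WINDOW LAW (energy ½-Hölder at `T`): `∫_a^T Z ≤ K√(T−a)` for all `a ∈ [0,T)` (p820364).

The only analytic inputs are the tree's two-time Serrin–Grönwall step under the rate (through
`QuarterLawOctave.quarterLaw_of_octaveSampled` and `QuarterLawWindow.quarterLaw_of_terminalWindowLaw_of_rate`)
and Chebyshev on a window; `1 ⟺ 2` needs no rate.

HONEST FRAMING: equivalences between forms of the conclusion of an OPEN crux along a HYPOTHETICAL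
blow-up; none of 1–6 is proved; `QuarterLawTypeI` (23726) remains OPEN; nothing about Navier–Stokes
regularity is claimed. [folklore]
-/

-- the problem directory repeats the summit name (`NavierStokesRegularity/NavierStokesRegularity`)
set_option linter.dupNamespace false

noncomputable section

open Set Filter Topology MeasureTheory
open scoped ENNReal NNReal

namespace Summit.NavierStokesRegularity.NavierStokesRegularity.Theorems

namespace QuarterLawOctave

open Literature.Analysis.FluidPDE
open Summit.NavierStokesRegularity.NavierStokesRegularity.Theorems.QuarterLawWindow
  (quarterLaw_of_terminalWindowLaw_of_rate exists_rate_of_isTypeIBlowup')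

/-- The dyadic times `T − T/2^{n+1}` lie in `[0,T)` for `T > 0`. [folklore] -/
theorem dyadic_mem_Ico {T : ℝ} (hT : 0 < T) (n : ℕ) : T - T / 2 ^ (n + 1) ∈ Ico 0 T := by
  have h1 : T / 2 ^ (n + 1) ≤ T := div_le_self hT.le (one_le_pow₀ (by norm_num))
  have h2 : 0 < T / 2 ^ (n + 1) := by positivity
  exact ⟨by linarith, by linarith⟩

/-- The dyadic times converge to `T`. [folklore] -/
theorem tendsto_dyadic (T : ℝ) : Tendsto (fun n : ℕ => T - T / 2 ^ (n + 1)) atTop (𝓝 T) := by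
  have h0 : Tendsto (fun n : ℕ => T / 2 ^ (n + 1)) atTop (𝓝 0) := by
    have hg : Tendsto (fun n : ℕ => ((1 : ℝ) / 2) ^ (n + 1)) atTop (𝓝 0) :=
      (tendsto_pow_atTop_nhds_zero_of_lt_one (by norm_num) (by norm_num)).comp
        (tendsto_add_atTop_nat 1)
    have := hg.const_mul T
    simp only [mul_zero] at this
    refine this.congr fun n => ?_
    rw [one_div, inv_pow, div_eq_mul_inv]
  have := h0.const_sub T
  simpa only [sub_zero] using this

/-- The dyadic times have scale ratio `2`: `T − t_n = 2(T − t_{n+1})`. [folklore] -/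
theorem dyadic_ratio (T : ℝ) (n : ℕ) :
    T - (T - T / 2 ^ (n + 1)) ≤ 2 * (T - (T - T / 2 ^ (n + 1 + 1))) := by
  rw [sub_sub_cancel, sub_sub_cancel, pow_succ 2 (n + 1)]
  have h : (0 : ℝ) < 2 ^ (n + 1) := by positivity
  rw [mul_div_assoc', le_div_iff₀ (by positivity)]
  field_simp
  rfl

/-- **The time-sampling forms of the quarter law along one Type-I blow-up are equivalent** (see the
module docstring for the six forms). [folklore] -/
theorem quarterLaw_sampling_tfae {ν T : ℝ} (hν : 0 < ν) (hT : 0 < T)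
    {u : ℝ → EuclideanSpace ℝ (Fin 3) → EuclideanSpace ℝ (Fin 3)}
    {p : ℝ → EuclideanSpace ℝ (Fin 3) → ℝ}
    (hsol : IsClassicalNSSolutionOn (Ico 0 T) ν 0 u p) (hLH : IsLerayHopfOn T ν 0 (u 0) u)
    (hdec : HasRapidSpatialDecay (u 0)) (hI : IsTypeIBlowup u T) :
    [∃ K : ℝ, ∀ t ∈ Ico 0 T, ∫⁻ x, ‖curl (u t) x‖ₑ ^ 2 ≤ ENNReal.ofReal (K / Real.sqrt (T - t)),
      ∃ K t₀ : ℝ, t₀ < T ∧ ∀ t ∈ Ico t₀ T,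
        ∫⁻ x, ‖curl (u t) x‖ₑ ^ 2 ≤ ENNReal.ofReal (K / Real.sqrt (T - t)),
      ∃ K q t₀ : ℝ, t₀ < T ∧ ∀ t ∈ Ico t₀ T, ∃ s ∈ Icc 0 t, T - s ≤ q * (T - t) ∧
        ∫⁻ x, ‖curl (u s) x‖ₑ ^ 2 ≤ ENNReal.ofReal (K / Real.sqrt (T - s)),
      ∃ K : ℝ, ∀ n : ℕ, ∫⁻ x, ‖curl (u (T - T / 2 ^ (n + 1))) x‖ₑ ^ 2 ≤
        ENNReal.ofReal (K / Real.sqrt (T / 2 ^ (n + 1))),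
      ∃ K t₀ : ℝ, t₀ < T ∧ T ≤ 2 * t₀ ∧ ∀ t ∈ Ico t₀ T,
        ∫⁻ s in Ioo (2 * t - T) t, ∫⁻ x, ‖curl (u s) x‖ₑ ^ 2 ≤
          ENNReal.ofReal (K * Real.sqrt (T - t)),
      ∃ K : ℝ, ∀ a ∈ Ico 0 T,
        ∫⁻ s in Ioo a T, ∫⁻ x, ‖curl (u s) x‖ₑ ^ 2 ≤
          ENNReal.ofReal (K * Real.sqrt (T - a))].TFAE := by
  obtain ⟨C, hC⟩ := exists_rate_of_isTypeIBlowup' hν hI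
  -- a nonnegative version of any slice constant
  have nonneg : ∀ {K : ℝ}, (∀ t ∈ Ico 0 T,
      ∫⁻ x, ‖curl (u t) x‖ₑ ^ 2 ≤ ENNReal.ofReal (K / Real.sqrt (T - t))) →
      ∀ t ∈ Ico 0 T, ∫⁻ x, ‖curl (u t) x‖ₑ ^ 2 ≤
        ENNReal.ofReal (max K 0 / Real.sqrt (T - t)) := fun hK t ht =>
    (hK t ht).trans (ENNReal.ofReal_le_ofReal
      (div_le_div_of_nonneg_right (le_max_left _ _) (Real.sqrt_nonneg _)))
  tfae_have 1 → 2 := fun ⟨K, hK⟩ => ⟨K, 0, hT, hK⟩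
  tfae_have 2 → 1 := fun h => LorentzOfEnvelope.quarterLaw_of_eventually hν hT hsol hLH hdec h
  tfae_have 1 → 3 := fun ⟨K, hK⟩ =>
    ⟨K, 1, 0, hT, fun t ht => ⟨t, ⟨ht.1, le_rfl⟩, (one_mul (T - t)).ge, hK t ht⟩⟩
  tfae_have 3 → 1 := fun h => quarterLaw_of_octaveSampled hν hT hsol hLH hdec hC h
  tfae_have 1 → 4 := by
    rintro ⟨K, hK⟩
    refine ⟨K, fun n => ?_⟩
    have := hK _ (dyadic_mem_Ico hT n)
    rwa [sub_sub_cancel] at this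
  tfae_have 4 → 1 := by
    rintro ⟨K, hK⟩
    exact quarterLaw_of_lacunarySeq hν hT hsol hLH hdec hC (fun n => T - T / 2 ^ (n + 1))
      (dyadic_mem_Ico hT) (tendsto_dyadic T) ⟨2, dyadic_ratio T⟩
      ⟨K, fun n => by rw [sub_sub_cancel]; exact hK n⟩
  tfae_have 1 → 6 := by
    rintro ⟨K, hK⟩
    refine ⟨2 * max K 0, fun a ha => ?_⟩
    exact WindowConverters.lintegral_Ioo_le_sqrt_of_slice_le (le_max_right _ _) (nonneg hK)
      ha.1 ha.2.le le_rfl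
  tfae_have 6 → 1 := fun h => quarterLaw_of_terminalWindowLaw_of_rate hν hT hsol hLH hdec hC h
  tfae_have 1 → 5 := by
    rintro ⟨K, hK⟩
    refine ⟨2 * max K 0, T / 2, by linarith, by linarith, fun t ht => ?_⟩
    have h := WindowConverters.lintegral_Ioo_le_sqrt_of_slice_le (le_max_right _ _) (nonneg hK)
      (a := 2 * t - T) (b := t) (by linarith [ht.1]) (by linarith [ht.2]) ht.2.le
    have e : t - (2 * t - T) = T - t := by ring
    rwa [e] at h
  tfae_have 5 → 3 := by
    rintro ⟨K, t₀, ht₀T, hTt₀, hwin⟩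
    refine ⟨Real.sqrt 2 * (max K 0 + 1), 2, t₀, ht₀T, fun t ht => ?_⟩
    set δ : ℝ := T - t with hδ
    have hδ0 : 0 < δ := by rw [hδ]; exact sub_pos.2 ht.2
    have hsδ : 0 < Real.sqrt δ := Real.sqrt_pos.2 hδ0
    -- Chebyshev: a good slice in the window `(2t−T, t)`
    set B : ℝ := (max K 0 + 1) / Real.sqrt δ with hB_def
    have hB0 : 0 < B := by positivity
    have hgood : ∃ s ∈ Ioo (2 * t - T) t,
        ∫⁻ x, ‖curl (u s) x‖ₑ ^ 2 ≤ ENNReal.ofReal B := by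
      by_contra hne
      push Not at hne
      have hlow : ENNReal.ofReal B * volume (Ioo (2 * t - T) t) ≤
          ∫⁻ s in Ioo (2 * t - T) t, ∫⁻ x, ‖curl (u s) x‖ₑ ^ 2 := by
        rw [← setLIntegral_const]
        exact setLIntegral_mono' measurableSet_Ioo fun s hs => (hne s hs).le
      rw [Real.volume_Ioo, show t - (2 * t - T) = δ by rw [hδ]; ring,
        ← ENNReal.ofReal_mul hB0.le] at hlow
      have hBδ : B * δ = (max K 0 + 1) * Real.sqrt δ := by
        rw [hB_def, div_mul_eq_mul_div, mul_div_assoc, Real.div_sqrt]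
      have hlt : ENNReal.ofReal (K * Real.sqrt δ) < ENNReal.ofReal (B * δ) := by
        rw [ENNReal.ofReal_lt_ofReal_iff (mul_pos hB0 hδ0), hBδ]
        have : K ≤ max K 0 := le_max_left _ _
        nlinarith [hsδ]
      exact absurd ((hlow.trans (hwin t ht)).trans_lt hlt) (lt_irrefl _)
    obtain ⟨s, hs, hZs⟩ := hgood
    have hs0 : 0 ≤ s := by linarith [hs.1, ht.1]
    have hTs : T - s ≤ 2 * δ := by rw [hδ]; linarith [hs.1]
    have hTs0 : 0 < T - s := by linarith [hs.2, ht.2]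
    refine ⟨s, ⟨hs0, hs.2.le⟩, hTs, hZs.trans (ENNReal.ofReal_le_ofReal ?_)⟩
    -- `B = (K⁺+1)/√δ ≤ √2 (K⁺+1)/√(T−s)` since `T − s ≤ 2δ`
    rw [hB_def, div_le_div_iff₀ hsδ (Real.sqrt_pos.2 hTs0)]
    have h2 : Real.sqrt (T - s) ≤ Real.sqrt 2 * Real.sqrt δ := by
      rw [← Real.sqrt_mul (by norm_num)]
      exact Real.sqrt_le_sqrt hTs
    have hK0 : 0 ≤ max K 0 + 1 := by positivity
    calc (max K 0 + 1) * Real.sqrt (T - s) ≤ (max K 0 + 1) * (Real.sqrt 2 * Real.sqrt δ) :=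
          mul_le_mul_of_nonneg_left h2 hK0
      _ = Real.sqrt 2 * (max K 0 + 1) * Real.sqrt δ := by ring
  tfae_finish

end QuarterLawOctave

end Summit.NavierStokesRegularity.NavierStokesRegularity.Theorems
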